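import Literature.MathematicalPhysics.QuantumLattice.FlatBandFerromagnetismMielke
import HarnessLib

/-!
# The converse half of Mielke's theorem: a reducible flat band has degenerate ground states

Topic `MathematicalPhysics/QuantumLattice` (Hubbard family; rigorous ferromagnetism). Completes
`FlatBandFerromagnetismMielke.lean` (`mielke_flatBand_ferromagnetism`: irreducible ⇒ the saturated
ferromagnetic multiplet is the unique ground state at `N_e = N_d`) to the printed equivalence

> "If the number of electrons is equal to `N_d`, … the ferromagnetic ground state is unique if and
> only if the single-particle density matrix is irreducible" [Mielke 1999, abstract; §4, last
> sentence]; "If the matrix `ρ_{x,y}` is reducible, the equation for `ρ̃_{y,x}` has another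
> non-trivial solution … Thus `ψ_{0F}` is stable with respect to a single spin flip if and only if
> `ρ_{x,y}` is irreducible" [Mielke 1999, §4].

**Theorem (`mielke_finrank_groundKer_of_not_isIrreducible`, `mielke_isIrreducible_iff`).** For a Gram
hopping `T = t Σ_a |u_a⟩⟨u_a|`, `t > 0`, `U > 0`, `N_e = N_d = dim 𝒦`: if the flat band `𝒦` is
REDUCIBLE (Mielke), the ground multiplet `{Hψ = E₀ψ, N̂ψ = N_dψ}` has dimension at least `N_d + 2`, so the
ferromagnetic ground state is NOT unique up to the `SU(2)` degeneracy; together with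
`mielke_flatBand_ferromagnetism`: `𝒦` irreducible ⇔ the ground multiplet has dimension exactly `N_d + 1`.

**Proof (a shorter road than the printed single-spin-flip construction, same mechanism).** In Mielke's
basis (`exists_mielkeBasis`, weighted normal form `(D, w)` of `FlatBandFerromagnetismWeighted.lean`) a
cutoff-stable splitting `S` of `𝒦` splits the flat-band sites `D = D₁ ⊔ D₂` (`D₁ = D ∩ S`, both parts
inhabited) with `ψ_k` supported in `S` for `k ∈ D₁` and in `Sᶜ` for `k ∈ D₂`
(`exists_splitting_of_not_isIrreducible`). The mixed product
`φ = Π_{k ∈ D₁} C†_↑(ψ_k) Π_{k ∈ D₂} C†_↓(ψ_k) |0⟩` is then a zero-energy `N_d`-particle state: it is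
killed by every `C_σ(w_x)` (anticommutation, `⟨w_x, ψ_k⟩ = 0`) and has no double occupancy (up
electrons live in `S`, down electrons in `Sᶜ`) — [Mielke 1999, §2]: "a ground state of the kinetic part
and of the interaction part separately". It vanishes on every internal-free configuration
`α↑ ∪ (D∖α)↓` with `α ≠ D₁` (its up electrons on `D` sit exactly on `D₁`), whereas the member
`(S⁻)^{|D₂|} ψ_{0F}` of the ferromagnetic multiplet has amplitude `|D₂|! · ψ_{0F}(D↑) ≠ 0` there
(`spinMinus_pow_ferro_apply`); hence `φ` is not in the multiplet and the `N_d + 2` vectors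
`φ, ψ_{0F}, S⁻ψ_{0F}, …, (S⁻)^{N_d}ψ_{0F}` are linearly independent ground states.

## References

* A. Mielke, *Stability of ferromagnetism in Hubbard models with degenerate single-particle ground
  states*, J. Phys. A **32** (1999) 8411 = arXiv:cond-mat/9910385, abstract, §2, §4 [Mielke1999]
  (held text pp. 2, 4–7).
* A. Mielke, Phys. Lett. A **174** (1993) 443 [Mielke1993].
-/

noncomputable section

open Matrix Finset Module
open scoped ComplexOrder

namespace Literature.MathematicalPhysics.QuantumLattice

namespace FlatBand

variable {Λ : Type*} [LinearOrder Λ] [Fintype Λ]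

/-! ### Mixed-spin product states in the weighted normal form -/

section MixedProducts

variable (D : Finset Λ) (w : Λ → Λ → ℝ)

/-- The mixed-spin product state `Π_{(k,σ) ∈ L} C†_σ(ν^k) |0⟩` over a list of (flat-band site, spin)
pairs (for all spins up this is `wLocProd`). [cite: Mielke1999, §2 ("Any multi particle state that
contains only electron with spin up in single particle states `φ^i` … is a ground state"; here with
both spins on disjointly supported orbitals)] -/
def wSpinProd (L : List (Λ × Fin 2)) : Fock (Orb Λ) :=
  (L.map fun p => fieldCre (wLocVec D w p.1) p.2).prod *ᵥ vacuum

/-- The occupied orbitals `{k_σ : (k,σ) ∈ L}` of the mixed product on the flat-band sites. [folklore] -/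
def spinCfg (L : List (Λ × Fin 2)) : Finset (Orb Λ) := (L.map fun p => orb p.1 p.2).toFinset

variable {D w}

omit [Fintype Λ] in
/-- Membership in `spinCfg`. [folklore] -/
private theorem orb_mem_spinCfg {L : List (Λ × Fin 2)} {x : Λ} {σ : Fin 2} :
    orb x σ ∈ spinCfg L ↔ (x, σ) ∈ L := by
  rw [spinCfg, List.mem_toFinset, List.mem_map]
  constructor
  · rintro ⟨⟨y, τ⟩, hy, h⟩
    obtain ⟨rfl, rfl⟩ := orb_inj.1 h
    exact hy
  · intro h
    exact ⟨(x, σ), h, rfl⟩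

omit [Fintype Λ] in
/-- `spinCfg` of a cons. [folklore] -/
private theorem spinCfg_cons (p : Λ × Fin 2) (L : List (Λ × Fin 2)) :
    spinCfg (p :: L) = insert (orb p.1 p.2) (spinCfg L) := by
  rw [spinCfg, List.map_cons, List.toFinset_cons, spinCfg]

/-- Unfolding the mixed product at a cons. [folklore] -/
private theorem wSpinProd_cons (p : Λ × Fin 2) (L : List (Λ × Fin 2)) :
    wSpinProd D w (p :: L) = fieldCre (wLocVec D w p.1) p.2 *ᵥ wSpinProd D w L := by
  rw [wSpinProd, List.map_cons, List.prod_cons, ← mulVec_mulVec, wSpinProd]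

/-- `C_σ(w_x)` anticommutes with every `C†_τ(ν^k)` (`x ∉ D`, `k ∈ D`): `⟨w_x, ν^k⟩ = 0`.
[cite: Mielke1999, §3 (the commutation relations of the flat-band operators `a_{iσ}`, `a†_{jτ}`)] -/
theorem fieldAnn_w_mul_fieldCre_wLocVec (hw0 : ∀ x, x ∉ D → w x x ≠ 0)
    (hwD : ∀ x, x ∉ D → ∀ y, y ≠ x → y ∉ D → w x y = 0) {x : Λ} (hx : x ∉ D)
    (σ τ : Fin 2) {k : Λ} (hk : k ∈ D) :
    fieldAnn (w x) σ * fieldCre (wLocVec D w k) τ = -(fieldCre (wLocVec D w k) τ * fieldAnn (w x) σ) := by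
  have h := fieldAnn_mul_fieldCre_add (w x) (wLocVec D w k) σ τ
  rw [sum_w_mul_wLocVec hw0 hwD hx hk] at h
  simp only [Complex.ofReal_zero, zero_smul, ite_self] at h
  exact eq_neg_of_add_eq_zero_left h

/-- `C_σ(w_x)` kills every mixed product state (`x ∉ D`, all sites of `L` in `D`).
[cite: Mielke1999, §2 ("a ground state of the kinetic part")] -/
theorem fieldAnn_w_mulVec_wSpinProd (hw0 : ∀ x, x ∉ D → w x x ≠ 0)
    (hwD : ∀ x, x ∉ D → ∀ y, y ≠ x → y ∉ D → w x y = 0) {x : Λ} (hx : x ∉ D)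
    (σ : Fin 2) {L : List (Λ × Fin 2)} (hL : ∀ p ∈ L, p.1 ∈ D) :
    fieldAnn (w x) σ *ᵥ wSpinProd D w L = 0 := by
  induction L with
  | nil => rw [wSpinProd, List.map_nil, List.prod_nil, one_mulVec, fieldAnn_mulVec_vacuum]
  | cons p L ih =>
    rw [wSpinProd_cons, mulVec_mulVec, fieldAnn_w_mul_fieldCre_wLocVec hw0 hwD hx σ p.2 (hL p (by simp)),
      neg_mulVec, ← mulVec_mulVec, ih (fun q hq => hL q (by simp [hq])), mulVec_zero, neg_zero]

/-- **Support of the mixed products**: a configuration with nonzero amplitude has as many orbitals as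
factors, and each of its orbitals `y_σ` lies in the support of some factor of the same spin
(`ν^k(y) ≠ 0`, `(k, σ) ∈ L`). [folklore] -/
private theorem wSpinProd_apply_ne_zero {L : List (Λ × Fin 2)} {s : Finset (Orb Λ)} (h : wSpinProd D w L s ≠ 0) :
    (∀ o ∈ s, ∃ p ∈ L, p.2 = (ofLex o).2 ∧ wLocVec D w p.1 (ofLex o).1 ≠ 0) ∧ s.card = L.length := by
  induction L generalizing s with
  | nil =>
    rw [wSpinProd, List.map_nil, List.prod_nil, one_mulVec, vacuum] at h
    by_cases hs : s = ∅
    · subst hs; simp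
    · exact absurd (Pi.single_eq_of_ne hs _) h
  | cons p L ih =>
    rw [wSpinProd_cons, fieldCre, sum_mulVec, Finset.sum_apply] at h
    obtain ⟨x, -, hx⟩ := Finset.exists_ne_zero_of_sum_ne_zero h
    rw [smul_mulVec, Pi.smul_apply, smul_eq_mul, creation_mulVec_apply] at hx
    by_cases hxs : orb x p.2 ∈ s
    · rw [if_pos hxs] at hx
      have hvx : wLocVec D w p.1 x ≠ 0 := fun h0 => by
        rw [h0, Complex.ofReal_zero, zero_mul] at hx; exact hx rfl
      have h' : wSpinProd D w L (s.erase (orb x p.2)) ≠ 0 := fun h0 => by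
        rw [h0, mul_zero, mul_zero] at hx; exact hx rfl
      obtain ⟨hcov, hcard⟩ := ih h'
      refine ⟨fun o ho => ?_, ?_⟩
      · by_cases hox : o = orb x p.2
        · refine ⟨p, by simp, ?_, ?_⟩
          · rw [hox]; rfl
          · rw [hox]; exact hvx
        · obtain ⟨q, hq, hq2, hq1⟩ := hcov o (mem_erase.2 ⟨hox, ho⟩)
          exact ⟨q, by simp [hq], hq2, hq1⟩
      · rw [List.length_cons, ← hcard, card_erase_add_one hxs]
    · rw [if_neg hxs, mul_zero] at hx
      exact absurd rfl hx

/-- **The mixed product is nonzero**: its amplitude on its own orbital set `{k_σ}` is `± 1` (distinct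
sites `k ∈ D`; only the `δ_k` parts of the `ν^k` contribute). [cite: Mielke1999, §3 (linear independence
of the `ψ_i`, `ψ̄_i(x) = δ_{x,i}`)] -/
theorem wSpinProd_apply_spinCfg_ne_zero {L : List (Λ × Fin 2)} (hnd : (L.map Prod.fst).Nodup)
    (hL : ∀ p ∈ L, p.1 ∈ D) : wSpinProd D w L (spinCfg L) ≠ 0 := by
  induction L with
  | nil => simp [wSpinProd, vacuum, spinCfg]
  | cons p L ih =>
    have hpL : p.1 ∉ L.map Prod.fst := (List.nodup_cons.1 (by simpa using hnd)).1
    have ih' := ih (List.nodup_cons.1 (by simpa using hnd)).2 (fun q hq => hL q (by simp [hq]))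
    have hnot : orb p.1 p.2 ∉ spinCfg L := fun h => by
      rw [orb_mem_spinCfg] at h
      exact hpL (List.mem_map.2 ⟨_, h, rfl⟩)
    rw [wSpinProd_cons, fieldCre, sum_mulVec, Finset.sum_apply, Finset.sum_eq_single p.1]
    · rw [smul_mulVec, Pi.smul_apply, smul_eq_mul, creation_mulVec_apply, spinCfg_cons,
        if_pos (mem_insert_self _ _), erase_insert hnot, wLocVec, if_pos rfl, Complex.ofReal_one, one_mul]
      exact mul_ne_zero (jwSign_ne_zero _ _) ih'
    · intro x _ hxp
      rw [smul_mulVec, Pi.smul_apply, smul_eq_mul, creation_mulVec_apply]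
      by_cases hx : orb x p.2 ∈ spinCfg (p :: L)
      · have hxD : x ∈ D := by
          rw [orb_mem_spinCfg] at hx
          exact hL _ hx
        rw [wLocVec, if_neg hxp, if_neg (not_not_intro hxD), Complex.ofReal_zero, zero_mul]
      · rw [if_neg hx, mul_zero]
    · intro h; exact absurd (mem_univ _) h

end MixedProducts

/-! ### The lowering string on internal-free configurations -/

section LoweringString

variable {D : Finset Λ} {w : Λ → Λ → ℝ}

/-- **Amplitudes of `(S⁻)^b ψ_{0F}` on the internal-free configurations**: for `α ⊆ D` with
`|α| + b = |D|`, `((S⁻)^b ψ_{0F})(α↑ ∪ (D∖α)↓) = b! · ψ_{0F}(D↑)` (each lowering moves one up electron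
of `D ∖ α` down, no Jordan–Wigner signs, `b!` orderings). [cite: Mielke1999, §3 (the multiplet
`ψ^{n,m}(α) = S_-^{n,m}(α) ψ_{0F}` of the ferromagnetic ground state)] -/
theorem spinMinus_pow_ferro_apply (b : ℕ) {α : Finset Λ} (hα : α ⊆ D) (hcard : α.card + b = D.card) :
    (spinMinus ^ b *ᵥ wFerroState D w) (pairSet α (D \ α)) =
      (b.factorial : ℂ) * wFerroState D w (pairSet D ∅) := by
  induction b generalizing α with
  | zero =>
    have hαD : α = D := Finset.eq_of_subset_of_card_le hα (by omega)
    rw [pow_zero, one_mulVec, hαD, sdiff_self, Nat.factorial_zero, Nat.cast_one, one_mul]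
    rfl
  | succ b ih =>
    rw [pow_succ', ← mulVec_mulVec, LiebTwo.spinMinus_mulVec_pairSet]
    have hset : (D \ α) \ α = D \ α := by
      rw [sdiff_sdiff_left, sup_idem]
    rw [hset]
    have hterm : ∀ x ∈ D \ α, (spinMinus ^ b *ᵥ wFerroState D w) (pairSet (insert x α) ((D \ α).erase x)) =
        (b.factorial : ℂ) * wFerroState D w (pairSet D ∅) := by
      intro x hx
      obtain ⟨hxD, hxα⟩ := mem_sdiff.1 hx
      have h1 : (D \ α).erase x = D \ insert x α := by
        rw [← sdiff_singleton_eq_erase, sdiff_sdiff_left, sup_eq_union, union_comm, ← insert_eq]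
      rw [h1]
      exact ih (insert_subset hxD hα) (by rw [card_insert_of_notMem hxα]; omega)
    rw [Finset.sum_congr rfl hterm, sum_const, card_sdiff_of_subset hα, nsmul_eq_mul, Nat.factorial_succ]
    push_cast
    have : (D.card - α.card : ℕ) = b + 1 := by omega
    rw [this]
    push_cast
    ring

/-- `ψ_{0F}(D↑) ≠ 0`. [cite: Mielke1999, §3 (`ψ_{0F} = Π_i a†_{i↑}|0⟩`)] -/
theorem wFerroState_apply_pairSet_ne_zero : wFerroState D w (pairSet D ∅) ≠ 0 := by
  have h := wLocProd_apply_pairSet_ne_zero (D := D) (w := w) (D.sort_nodup (· ≤ ·))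
    (fun y hy => (Finset.mem_sort _).1 hy)
  rwa [Finset.sort_toFinset] at h

end LoweringString

/-! ### Reducibility in Mielke's basis: the splitting of the flat-band sites -/

section Splitting

variable {D : Finset Λ} {ψ : Λ → Λ → ℝ}

omit [Fintype Λ] in
/-- **A reducible flat band splits Mielke's basis**: if `𝒦` is reducible (a cutoff-stable splitting `S`
with both parts of `𝒦` nonzero), then some basis sites `k ∈ D` lie in `S` and some outside, `ψ_k` is
supported in `S` for `k ∈ D ∩ S` and in `Sᶜ` for `k ∈ D ∖ S` ("the set `{ψ_k(x)}` decays in two subsets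
such that `ψ_k(x)ψ_{k'}(x) = 0` if the two factors are out of different subsets").
[cite: Mielke1999, §4] -/
theorem exists_splitting_of_not_isIrreducible {K : Submodule ℝ (Λ → ℝ)}
    (hψK : ∀ k ∈ D, ψ k ∈ K) (hψD : ∀ k ∈ D, ∀ y ∈ D, ψ k y = if y = k then 1 else 0)
    (hexp : ∀ v ∈ K, ∀ y, v y = ∑ k ∈ D, v k * ψ k y) (hred : ¬ IsIrreducible K) :
    ∃ S : Finset Λ, (∃ k ∈ D, k ∈ S) ∧ (∃ k ∈ D, k ∉ S) ∧
      (∀ k ∈ D, k ∈ S → ∀ y, ψ k y ≠ 0 → y ∈ S) ∧ (∀ k ∈ D, k ∉ S → ∀ y, ψ k y ≠ 0 → y ∉ S) := by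
  classical
  obtain ⟨S, hS⟩ := not_forall.1 hred
  obtain ⟨hstab, hAB⟩ := Classical.not_imp.1 hS
  obtain ⟨hA, hB⟩ := not_or.1 hAB
  -- supports
  have hsuppS : ∀ k ∈ D, k ∈ S → ∀ y, ψ k y ≠ 0 → y ∈ S := by
    intro k hk hkS y hy
    by_contra hyS
    -- `r = ψ_k - cutoff S ψ_k ∈ K` vanishes on `D`, hence everywhere
    have hr : ψ k - cutoff S (ψ k) ∈ K := K.sub_mem (hψK k hk) (hstab _ (hψK k hk))
    have hrD : ∀ k' ∈ D, (ψ k - cutoff S (ψ k)) k' = 0 := by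
      intro k' hk'
      rw [Pi.sub_apply, cutoff_apply, hψD k hk k' hk']
      by_cases hk'k : k' = k
      · subst hk'k; rw [if_pos rfl, if_pos hkS, sub_self]
      · rw [if_neg hk'k]; split_ifs <;> simp
    have hry : (ψ k - cutoff S (ψ k)) y = 0 := by
      rw [hexp _ hr y]
      exact Finset.sum_eq_zero fun k' hk' => by rw [hrD k' hk', zero_mul]
    rw [Pi.sub_apply, cutoff_apply, if_neg hyS, sub_zero] at hry
    exact hy hry
  have hsuppSc : ∀ k ∈ D, k ∉ S → ∀ y, ψ k y ≠ 0 → y ∉ S := by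
    intro k hk hkS y hy hyS
    have hr : cutoff S (ψ k) ∈ K := hstab _ (hψK k hk)
    have hrD : ∀ k' ∈ D, cutoff S (ψ k) k' = 0 := by
      intro k' hk'
      rw [cutoff_apply, hψD k hk k' hk']
      by_cases hk'k : k' = k
      · subst hk'k; rw [if_neg hkS]
      · rw [if_neg hk'k, ite_self]
    have hry : cutoff S (ψ k) y = 0 := by
      rw [hexp _ hr y]
      exact Finset.sum_eq_zero fun k' hk' => by rw [hrD k' hk', zero_mul]
    rw [cutoff_apply, if_pos hyS] at hry
    exact hy hry
  refine ⟨S, ?_, ?_, hsuppS, hsuppSc⟩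
  · -- some basis site lies in `S`: otherwise `K` vanishes on `S`
    by_contra hnone
    push Not at hnone
    apply hA
    intro v hv y hyS
    rw [hexp v hv y]
    refine Finset.sum_eq_zero fun k hk => ?_
    by_cases hky : ψ k y = 0
    · rw [hky, mul_zero]
    · exact absurd hyS (hsuppSc k hk (hnone k hk) y hky)
  · by_contra hnone
    push Not at hnone
    apply hB
    intro v hv y hyS
    rw [hexp v hv y]
    refine Finset.sum_eq_zero fun k hk => ?_
    by_cases hky : ψ k y = 0
    · rw [hky, mul_zero]
    · exact absurd (hsuppS k hk (hnone k hk) y hky) hyS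

omit [Fintype Λ] in
/-- In Mielke's normal form the dual vectors `ν^k` of `FlatBandFerromagnetismWeighted.lean` ARE the basis
vectors `ψ_k` (`k ∈ D`). [cite: Mielke1999, §3 (`ψ = (ψ̄, -Cψ̄)`)] -/
theorem wLocVec_mielkeVec (hψD : ∀ k ∈ D, ∀ y ∈ D, ψ k y = if y = k then 1 else 0) {k : Λ} (hk : k ∈ D) :
    wLocVec D (mielkeVec D ψ) k = ψ k := by
  funext y
  rw [wLocVec]
  by_cases hyk : y = k
  · rw [if_pos hyk, hyk, hψD k hk k hk, if_pos rfl]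
  · rw [if_neg hyk]
    by_cases hyD : y ∈ D
    · rw [if_neg (not_not_intro hyD), hψD k hk y hyD, if_neg hyk]
    · rw [if_pos hyD, mielkeVec_of_mem hyD hk, mielkeVec_self]; ring

end Splitting

/-! ### The theorem -/

section Main

variable {D : Finset Λ} {w : Λ → Λ → ℝ}

/-- Membership in the ground multiplet `ker(H - e) ∩ {N̂ = N}`. [folklore] -/
private theorem mem_groundKer_iff_gram' {ι : Type*} (A : Finset ι) (u : ι → Λ → ℝ) (t U : ℝ) (N : ℕ)
    (e : ℝ) (ψ : Fock (Orb Λ)) :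
    ψ ∈ LinearMap.ker (Matrix.toLin' (gramHamiltonian A u t U - ((e : ℝ) : ℂ) • 1)) ⊓
        LinearMap.ker (Matrix.toLin' (totalNumber - (N : ℂ) • (1 : Matrix _ _ ℂ))) ↔
      gramHamiltonian A u t U *ᵥ ψ = (e : ℂ) • ψ ∧ IsNParticle N ψ := by
  rw [Submodule.mem_inf, LinearMap.mem_ker, LinearMap.mem_ker, Matrix.toLin'_apply, Matrix.toLin'_apply,
    sub_mulVec, sub_mulVec, smul_mulVec, smul_mulVec, one_mulVec, sub_eq_zero, sub_eq_zero,
    LiebTwo.isNParticle_iff_totalNumber]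

/-- **A split normal form has at least `N_d + 2` independent ground states** (weighted normal form
`(D, w)`, `t > 0`, `U > 0`, `N_e = |D|`): if the flat-band sites split as `D = D₁ ⊔ D₂`, both parts
inhabited, with `ν^k` supported in `S` for `k ∈ D₁ = D ∩ S` and in `Sᶜ` for `k ∈ D₂`, then besides the
ferromagnetic multiplet `(S⁻)^j ψ_{0F}` (`j = 0, …, |D|`) the mixed product
`Π_{D₁} C†_↑(ν^k) Π_{D₂} C†_↓(ν^k)|0⟩` is a further, linearly independent ground state.
[cite: Mielke1999, §4 ("If the matrix `ρ_{x,y}` is reducible … another non-trivial solution")]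
[cite: Mielke1999, §2] -/
theorem finrank_groundKer_ge_of_splitting {ι : Type*} (A : Finset ι) (u : ι → Λ → ℝ) {t U : ℝ}
    (hw0 : ∀ x, x ∉ D → w x x ≠ 0) (hwD : ∀ x, x ∉ D → ∀ y, y ≠ x → y ∉ D → w x y = 0)
    (hspan : Submodule.span ℝ (u '' (A : Set ι)) = Submodule.span ℝ (w '' ((Dᶜ : Finset Λ) : Set Λ)))
    (ht : 0 < t) (hU : 0 < U) (S : Finset Λ) (hS1 : ∃ k ∈ D, k ∈ S) (hS2 : ∃ k ∈ D, k ∉ S)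
    (hsuppS : ∀ k ∈ D, k ∈ S → ∀ y, wLocVec D w k y ≠ 0 → y ∈ S)
    (hsuppSc : ∀ k ∈ D, k ∉ S → ∀ y, wLocVec D w k y ≠ 0 → y ∉ S) :
    D.card + 2 ≤ Module.finrank ℂ ↥(LinearMap.ker (Matrix.toLin' (gramHamiltonian A u t U -
          ((groundEnergy (gramHamiltonian A u t U) D.card : ℝ) : ℂ) • 1)) ⊓
        LinearMap.ker (Matrix.toLin' (totalNumber - (D.card : ℂ) • (1 : Matrix (Finset (Orb Λ)) _ ℂ)))) := by
  classical
  set H := gramHamiltonian A u t U with hH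
  set N := D.card with hN
  -- kernel conditions in the `w`-basis
  have hKiff : ∀ (σ : Fin 2) (φ : Fock (Orb Λ)),
      (∀ a ∈ A, fieldAnn (u a) σ *ᵥ φ = 0) ↔ (∀ x, x ∉ D → fieldAnn (w x) σ *ᵥ φ = 0) := by
    intro σ φ
    rw [forall_fieldAnn_mulVec_eq_zero_iff_of_span_eq hspan σ φ]
    simp only [Finset.mem_compl]
  have hker : ∀ φ : Fock (Orb Λ), H *ᵥ φ = 0 ↔
      (∀ x, x ∉ D → ∀ σ : Fin 2, fieldAnn (w x) σ *ᵥ φ = 0) ∧ IsGutzwiller φ := by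
    intro φ
    rw [hH, gramHamiltonian_mulVec_eq_zero_iff A u ht hU]
    constructor
    · rintro ⟨hK, hG⟩
      exact ⟨fun x hx σ => (hKiff σ φ).1 (fun a ha => hK a ha σ) x hx, hG⟩
    · rintro ⟨hK, hG⟩
      exact ⟨fun a ha σ => (hKiff σ φ).2 (fun x hx => hK x hx σ) a ha, hG⟩
  -- the ferromagnetic zero-energy state and `E₀ = 0`
  obtain ⟨hvS, hvG, hvK, hv0⟩ := wFerroState_spec (D := D) (w := w) hw0 hwD
  set v₀ := wFerroState D w with hv₀
  have hvN : IsNParticle N v₀ := by simpa using hvS.isNParticle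
  have hvH : H *ᵥ v₀ = 0 := (hker v₀).2 ⟨hvK, hvG⟩
  have hE0 : groundEnergy H N = 0 := groundEnergy_gramHamiltonian_eq_zero A u ht.le hU.le hvN hv0 hvH
  -- the lowering string
  have h3 := LiebTwo.isSu2Triple_spin (Λ := Λ)
  have hZv : HubbardWave0.spinZ *ᵥ v₀ = ((N : ℂ) / 2) • v₀ := by
    rw [LiebThm1.spinZ_mulVec_of_isInSector hvS]; congr 1; push_cast; ring
  have hPv : spinPlus *ᵥ v₀ = 0 := LiebThm1.raisesSpin_spinPlus.mulVec_eq_zero hvS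
  set v : ℕ → Fock (Orb Λ) := fun k => spinMinus ^ k *ᵥ v₀ with hv
  have hv_ne : ∀ k, k ≤ N → v k ≠ 0 := su2_lower_pow_ne_zero h3 hv0 hPv hZv
  have hv_H : ∀ k, H *ᵥ v k = 0 := fun k => by
    simp only [hv]
    rw [mulVec_mulVec, ((commute_gramHamiltonian_spinMinus A u t U).pow_right k).eq, ← mulVec_mulVec, hvH,
      mulVec_zero]
  have hcN : Commute (totalNumber : Matrix (Finset (Orb Λ)) (Finset (Orb Λ)) ℂ) spinMinus := by
    unfold Commute SemiconjBy; exact LiebTwo.totalNumber_mul_spinMinus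
  have hv_N : ∀ k, IsNParticle N (v k) := fun k =>
    LiebTwo.isNParticle_mulVec_of_commute hvN (hcN.pow_right k).eq
  have hv_sector : ∀ k, k ≤ N → IsInSector (N - k) k (v k) := by
    intro k
    induction k with
    | zero => intro _; simpa [hv] using hvS
    | succ k ih =>
      intro hk
      have h' := LiebThm1.lowersSpin_spinMinus.isInSector_mulVec
        (show IsInSector (N - (k + 1) + 1) k (v k) by
          have := ih (Nat.le_of_succ_le hk); rwa [show N - k = N - (k + 1) + 1 by omega] at this)
      simp only [hv, pow_succ', ← mulVec_mulVec]
      exact h'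
  -- the splitting of the flat-band sites
  set D1 := D.filter (· ∈ S) with hD1
  set D2 := D.filter (· ∉ S) with hD2
  have hD1D : D1 ⊆ D := filter_subset _ _
  have hD2D : D2 ⊆ D := filter_subset _ _
  have hD12 : Disjoint D1 D2 := by
    rw [hD1, hD2]; exact disjoint_filter_filter_not D D (· ∈ S)
  have hDunion : D1 ∪ D2 = D := by rw [hD1, hD2, filter_union_filter_not_eq]
  have hcard12 : D1.card + D2.card = N := by rw [← card_union_of_disjoint hD12, hDunion]
  have hD1ne : D1.Nonempty := by
    obtain ⟨k, hk, hkS⟩ := hS1; exact ⟨k, mem_filter.2 ⟨hk, hkS⟩⟩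
  have hD2ne : D2.Nonempty := by
    obtain ⟨k, hk, hkS⟩ := hS2; exact ⟨k, mem_filter.2 ⟨hk, hkS⟩⟩
  set b := D2.card with hb
  have hbN : b ≤ N := by omega
  -- the mixed product
  set L : List (Λ × Fin 2) := (D1.sort (· ≤ ·)).map (fun k => (k, (0 : Fin 2))) ++
    (D2.sort (· ≤ ·)).map (fun k => (k, (1 : Fin 2))) with hL
  have hmemL : ∀ p : Λ × Fin 2, p ∈ L ↔ (p.2 = 0 ∧ p.1 ∈ D1) ∨ (p.2 = 1 ∧ p.1 ∈ D2) := by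
    rintro ⟨k, σ⟩
    simp only [hL, List.mem_append, List.mem_map, Finset.mem_sort, Prod.mk.injEq]
    constructor
    · rintro (⟨k', hk', rfl, rfl⟩ | ⟨k', hk', rfl, rfl⟩)
      · exact Or.inl ⟨rfl, hk'⟩
      · exact Or.inr ⟨rfl, hk'⟩
    · rintro (⟨rfl, hk⟩ | ⟨rfl, hk⟩)
      · exact Or.inl ⟨k, hk, rfl, rfl⟩
      · exact Or.inr ⟨k, hk, rfl, rfl⟩
  have hLD : ∀ p ∈ L, p.1 ∈ D := by
    intro p hp
    rcases (hmemL p).1 hp with ⟨-, h⟩ | ⟨-, h⟩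
    · exact hD1D h
    · exact hD2D h
  have hLlen : L.length = N := by
    rw [hL, List.length_append, List.length_map, List.length_map, Finset.length_sort, Finset.length_sort,
      hcard12]
  have hLnd : (L.map Prod.fst).Nodup := by
    rw [hL, List.map_append, List.map_map, List.map_map]
    have h1 : ((D1.sort (· ≤ ·)).map (Prod.fst ∘ fun k => (k, (0 : Fin 2)))) = D1.sort (· ≤ ·) := by
      rw [show (Prod.fst ∘ fun k : Λ => (k, (0 : Fin 2))) = id from rfl, List.map_id]
    have h2 : ((D2.sort (· ≤ ·)).map (Prod.fst ∘ fun k => (k, (1 : Fin 2)))) = D2.sort (· ≤ ·) := by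
      rw [show (Prod.fst ∘ fun k : Λ => (k, (1 : Fin 2))) = id from rfl, List.map_id]
    rw [h1, h2, List.nodup_append]
    refine ⟨D1.sort_nodup _, D2.sort_nodup _, fun k hk1 k' hk2 hkk => ?_⟩
    rw [Finset.mem_sort] at hk1 hk2
    exact disjoint_left.1 hD12 hk1 (hkk ▸ hk2)
  set φ := wSpinProd D w L with hφ
  -- zero energy
  have hφK : ∀ x, x ∉ D → ∀ σ : Fin 2, fieldAnn (w x) σ *ᵥ φ = 0 :=
    fun x hx σ => fieldAnn_w_mulVec_wSpinProd hw0 hwD hx σ hLD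
  have hφG : IsGutzwiller φ := by
    intro s hs
    by_contra hne
    obtain ⟨x, hx0, hx1⟩ := hs
    obtain ⟨hcov, -⟩ := wSpinProd_apply_ne_zero hne
    obtain ⟨p, hp, hp2, hp1⟩ := hcov _ hx0
    obtain ⟨q, hq, hq2, hq1⟩ := hcov _ hx1
    have hp2' : p.2 = 0 := hp2
    have hq2' : q.2 = 1 := hq2
    rcases (hmemL p).1 hp with ⟨-, hpD1⟩ | ⟨h, -⟩
    · rcases (hmemL q).1 hq with ⟨h, -⟩ | ⟨-, hqD2⟩
      · rw [hq2'] at h; exact absurd h one_ne_zero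
      · have hxS : x ∈ S := hsuppS p.1 (hD1D hpD1) (mem_filter.1 hpD1).2 x hp1
        exact hsuppSc q.1 (hD2D hqD2) (mem_filter.1 hqD2).2 x hq1 hxS
    · rw [hp2'] at h; exact absurd h zero_ne_one
  have hφH : H *ᵥ φ = 0 := (hker φ).2 ⟨hφK, hφG⟩
  have hφ0 : φ ≠ 0 := fun h0 => by
    have := wSpinProd_apply_spinCfg_ne_zero (D := D) (w := w) hLnd hLD
    rw [← hφ, h0] at this
    exact this rfl
  have hφN : IsNParticle N φ := by
    intro s hs
    by_contra hne
    exact hs ((wSpinProd_apply_ne_zero hne).2.trans hLlen)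
  -- `φ` vanishes on the internal-free configurations `α↑ ∪ (D∖α)↓`, `α ≠ D₁`
  have hφvan : ∀ α : Finset Λ, α ⊆ D → α.card = D1.card → α ≠ D1 → φ (pairSet α (D \ α)) = 0 := by
    intro α hαD hαc hαne
    by_contra hne
    obtain ⟨hcov, -⟩ := wSpinProd_apply_ne_zero hne
    have hsub : α ⊆ D1 := by
      intro x hx
      obtain ⟨p, hp, hp2, hp1⟩ := hcov (orb x 0) ((orb_zero_mem_pairSet _ _ _).2 hx)
      have hp2' : p.2 = 0 := hp2
      rcases (hmemL p).1 hp with ⟨-, hpD1⟩ | ⟨h, -⟩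
      · -- `ν^{p.1}(x) ≠ 0` with `x ∈ D` forces `x = p.1`
        have hx1 : wLocVec D w p.1 x ≠ 0 := hp1
        rw [wLocVec] at hx1
        by_cases hxp : x = p.1
        · rw [hxp]; exact hpD1
        · rw [if_neg hxp, if_neg (not_not_intro (hαD hx))] at hx1; exact absurd rfl hx1
      · rw [hp2'] at h; exact absurd h zero_ne_one
    exact hαne (Finset.eq_of_subset_of_card_le hsub (by rw [hαc]))
  -- the down part of the mixed configuration
  have hcfg_down : downPart (spinCfg L) = D2 := by
    ext x
    rw [mem_downPart, orb_mem_spinCfg, hmemL]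
    simp
  have hcfg_up : upPart (spinCfg L) = D1 := by
    ext x
    rw [mem_upPart, orb_mem_spinCfg, hmemL]
    simp
  -- a competitor configuration `α ≠ D₁` of the same size
  obtain ⟨k₁, hk₁⟩ := hD1ne
  obtain ⟨k₂, hk₂⟩ := hD2ne
  set α₀ : Finset Λ := insert k₂ (D1.erase k₁) with hα₀
  have hk₂1 : k₂ ∉ D1 := fun h => disjoint_left.1 hD12 h hk₂
  have hα₀D : α₀ ⊆ D := by
    rw [hα₀]
    exact insert_subset (hD2D hk₂) ((erase_subset _ _).trans hD1D)
  have hα₀c : α₀.card = D1.card := by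
    rw [hα₀, card_insert_of_notMem (fun h => hk₂1 (mem_of_mem_erase h)), card_erase_add_one hk₁]
  have hα₀ne : α₀ ≠ D1 := fun h => hk₂1 (h ▸ mem_insert_self _ _)
  -- `φ` is not in the span of the string
  set bv : Fin (N + 1) → Fock (Orb Λ) := fun k => v k with hbv
  have hsec_eval : ∀ (c : Fin (N + 1) → ℂ) (s : Finset (Orb Λ)), (downPart s).card = b →
      (∑ k, c k • bv k) s = c ⟨b, by omega⟩ * v b s := by
    intro c s hs
    rw [Finset.sum_apply, Finset.sum_eq_single ⟨b, by omega⟩]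
    · rfl
    · intro k _ hkb
      rw [Pi.smul_apply, smul_eq_mul]
      change c k * v k s = 0
      have hne : (k : ℕ) ≠ b := fun h => hkb (Fin.ext h)
      rw [hv_sector k (Nat.lt_succ_iff.1 k.2) s (fun h => hne (by rw [← h.2, hs])), mul_zero]
    · intro h; exact absurd (mem_univ _) h
  have hφspan : φ ∉ Submodule.span ℂ (Set.range bv) := by
    intro hmem
    obtain ⟨c, hc⟩ := (Submodule.mem_span_range_iff_exists_fun ℂ).1 hmem
    -- evaluate at the competitor configuration: `c_b = 0`
    have h1 := congrFun hc (pairSet α₀ (D \ α₀))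
    rw [hsec_eval c _ (by rw [downPart_pairSet, card_sdiff_of_subset hα₀D]; omega),
      hφvan α₀ hα₀D hα₀c hα₀ne] at h1
    have hvb : v b (pairSet α₀ (D \ α₀)) ≠ 0 := by
      simp only [hv, hv₀]
      rw [spinMinus_pow_ferro_apply b hα₀D (by omega)]
      exact mul_ne_zero (by exact_mod_cast (Nat.factorial_pos b).ne') wFerroState_apply_pairSet_ne_zero
    have hcb : c ⟨b, by omega⟩ = 0 := (mul_eq_zero.1 h1).resolve_right hvb
    -- evaluate at the mixed configuration: `φ = 0` there, contradiction
    have h2 := congrFun hc (spinCfg L)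
    rw [hsec_eval c _ (by rw [hcfg_down]), hcb, zero_mul] at h2
    exact wSpinProd_apply_spinCfg_ne_zero (D := D) (w := w) hLnd hLD h2.symm
  -- linear independence of the string
  have hli : LinearIndependent ℂ bv := by
    rw [linearIndependent_iff']
    intro T g hg k hk
    have hvk := hv_ne k (Nat.lt_succ_iff.1 k.2)
    obtain ⟨s, hs⟩ : ∃ s, v k s ≠ 0 := by
      by_contra h'; push Not at h'; exact hvk (funext h')
    have hsec : (upPart s).card = N - k ∧ (downPart s).card = k := by
      by_contra h'; exact hs (hv_sector k (Nat.lt_succ_iff.1 k.2) s h')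
    have heval := congrFun hg s
    rw [Finset.sum_apply, Pi.zero_apply, Finset.sum_eq_single k] at heval
    · rw [Pi.smul_apply, smul_eq_mul] at heval
      exact (mul_eq_zero.1 heval).resolve_right hs
    · intro k' _ hk'
      rw [Pi.smul_apply, smul_eq_mul]
      change g k' * v k' s = 0
      have hne : (k' : ℕ) ≠ k := fun h => hk' (Fin.ext h)
      rw [hv_sector k' (Nat.lt_succ_iff.1 k'.2) s (fun h => hne (by rw [← h.2, hsec.2])), mul_zero]
    · intro h; exact absurd hk h
  have hli' : LinearIndependent ℂ (Fin.cons φ bv : Fin (N + 2) → Fock (Orb Λ)) :=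
    linearIndependent_finCons.2 ⟨hli, hφspan⟩
  -- all these vectors lie in the ground multiplet
  rw [hE0]
  set V := LinearMap.ker (Matrix.toLin' (H - ((0 : ℝ) : ℂ) • 1)) ⊓
    LinearMap.ker (Matrix.toLin' (totalNumber - (N : ℂ) • (1 : Matrix (Finset (Orb Λ)) _ ℂ))) with hVdef
  have hmem : ∀ ψ', ψ' ∈ V ↔ H *ᵥ ψ' = 0 ∧ IsNParticle N ψ' := fun ψ' => by
    rw [hVdef, hH, mem_groundKer_iff_gram', Complex.ofReal_zero, zero_smul]
  have hle : Submodule.span ℂ (Set.range (Fin.cons φ bv : Fin (N + 2) → Fock (Orb Λ))) ≤ V := by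
    rw [Submodule.span_le]
    rintro _ ⟨k, rfl⟩
    refine Fin.cases ?_ (fun i => ?_) k
    · rw [Fin.cons_zero]; exact (hmem _).2 ⟨hφH, hφN⟩
    · rw [Fin.cons_succ]; exact (hmem _).2 ⟨hv_H i, hv_N i⟩
  have hfr := finrank_span_eq_card hli'
  rw [Fintype.card_fin] at hfr
  calc N + 2 = Module.finrank ℂ ↥(Submodule.span ℂ (Set.range (Fin.cons φ bv : Fin (N + 2) → Fock (Orb Λ)))) :=
      hfr.symm
    _ ≤ Module.finrank ℂ ↥V := Submodule.finrank_mono hle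

end Main

/-! ### Mielke's equivalence -/

section Mielke

variable {ι : Type*} (A : Finset ι) (u : ι → Λ → ℝ) {t U : ℝ}

/-- **A reducible flat band has degenerate ground states** [Mielke 1999, §4; Mielke 1993]: for the Gram
hopping `T = t Σ_a |u_a⟩⟨u_a|`, `t > 0`, `U > 0`, `N_e = N_d`, if the flat band is NOT irreducible then
the ground multiplet `{Hψ = E₀ψ, N̂ψ = N_dψ}` has dimension at least `N_d + 2`: the saturated
ferromagnetic ground state is not unique up to the `SU(2)` degeneracy. [cite: Mielke1999, §4 (last
sentence: "unique ground state … if and only if `ρ_{xy}` is irreducible")] [cite: Mielke1993] -/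
theorem mielke_finrank_groundKer_of_not_isIrreducible (ht : 0 < t) (hU : 0 < U)
    (hred : ¬ IsIrreducible (flatBand A u)) :
    finrank ℝ (flatBand A u) + 2 ≤
      Module.finrank ℂ ↥(LinearMap.ker (Matrix.toLin' (gramHamiltonian A u t U -
          ((groundEnergy (gramHamiltonian A u t U) (finrank ℝ (flatBand A u)) : ℝ) : ℂ) • 1)) ⊓
        LinearMap.ker (Matrix.toLin' (totalNumber -
          (finrank ℝ (flatBand A u) : ℂ) • (1 : Matrix (Finset (Orb Λ)) _ ℂ)))) := by
  classical
  obtain ⟨D, ψ, hcard, hψK, hψD, hexp⟩ := exists_mielkeBasis (flatBand A u)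
  have hw0 : ∀ x, x ∉ D → mielkeVec D ψ x x ≠ 0 := fun x _ => by
    rw [mielkeVec_self]; exact one_ne_zero
  have hwD : ∀ x, x ∉ D → ∀ y, y ≠ x → y ∉ D → mielkeVec D ψ x y = 0 :=
    fun x _ y hyx hy => mielkeVec_of_notMem hyx hy
  obtain ⟨S, hS1, hS2, hsuppS, hsuppSc⟩ := exists_splitting_of_not_isIrreducible hψK hψD hexp hred
  rw [← hcard]
  refine finrank_groundKer_ge_of_splitting (D := D) (w := mielkeVec D ψ) A u hw0 hwD
    (span_eq_span_mielkeVec hcard hψK hψD hexp) ht hU S hS1 hS2 ?_ ?_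
  · intro k hk hkS y hy
    rw [wLocVec_mielkeVec hψD hk] at hy
    exact hsuppS k hk hkS y hy
  · intro k hk hkS y hy
    rw [wLocVec_mielkeVec hψD hk] at hy
    exact hsuppSc k hk hkS y hy

/-- **Mielke's equivalence** [Mielke 1993; Mielke 1999, §4]: for a Gram hopping with `t > 0`, `U > 0`
and `N_e = N_d` electrons, the flat band is irreducible IF AND ONLY IF the ground states reduce to the
single saturated ferromagnetic multiplet (ground multiplet of dimension exactly `N_d + 1`).
[cite: Mielke1999, §4 ("the ferromagnetic ground state of the Hubbard model with `N_e = N_d` electrons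
is the unique ground state (up to the spin degeneracy due to the `SU(2)` symmetry) if and only if `ρ_{xy}`
is irreducible")] [cite: Mielke1993] -/
theorem mielke_isIrreducible_iff (ht : 0 < t) (hU : 0 < U) :
    IsIrreducible (flatBand A u) ↔
      Module.finrank ℂ ↥(LinearMap.ker (Matrix.toLin' (gramHamiltonian A u t U -
          ((groundEnergy (gramHamiltonian A u t U) (finrank ℝ (flatBand A u)) : ℝ) : ℂ) • 1)) ⊓
        LinearMap.ker (Matrix.toLin' (totalNumber -
          (finrank ℝ (flatBand A u) : ℂ) • (1 : Matrix (Finset (Orb Λ)) _ ℂ)))) =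
        finrank ℝ (flatBand A u) + 1 := by
  constructor
  · intro hirr
    exact (mielke_flatBand_ferromagnetism A u ht hU hirr).2.2
  · intro h
    by_contra hred
    have := mielke_finrank_groundKer_of_not_isIrreducible A u ht hU hred
    omega

end Mielke

end FlatBand

end Literature.MathematicalPhysics.QuantumLattice
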